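import Literature.NumberTheory.EllipticCurves.NewformGaloisRepResidualOfThm61Proofs
import Literature.NumberTheory.GaloisRepresentations.DiscreteRepFrobeniusSeparation
import Literature.NumberTheory.GaloisRepresentations.ModPRepOfFrobeniusCharpolys
import Literature.NumberTheory.GaloisRepresentations.ResidualPairIntegrality
import Literature.NumberTheory.GaloisRepresentations.FramedRepEquivConj
import Literature.NumberTheory.ModularSymbols.CuspidalHomologyEigenpacketLift
import Literature.NumberTheory.ModularSymbols.CuspidalHomologyNormImageEigensystems
import Literature.NumberTheory.Automorphic.WeightTwoNewformOrdinaryAtPInLevel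
import Literature.NumberTheory.EllipticCurves.NewformsFiniteProofs
import Literature.NumberTheory.EllipticCurves.GreenbergSelmerOrdinaryFiltrationProofs
import HarnessLib

/-!
# Serre's weight of an irreducible mod-`3` system occurring in `H₁(X₀(L), ℤ)`, `9 ∤ L`, and in the
# `t`-norm image of `H₁(X₀(N), ℤ)`, `9 ∣ N`, `27 ∤ N` — GRANTED Deligne's theorem, Edixhoven's
# weight minimality and Darmon–Diamond–Taylor Thm. 3.1 (g)

Topic `Literature/NumberTheory/EllipticCurves`.  A *proofs* file (theorems only: no definition,
no named fact, no `sorry`; D-0026) assembling the printed argument behind the named fact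
`normImage_modThree_serreWeight_le_four` (`ModularJacobianNormImageSerreWeight.lean`) from the
tree's theorems, CONDITIONALLY on exactly the three deep named facts of the area that the tree
keeps un-discharged:

* `ModularForms.DeligneSerre1974.thm61_exists_adicGaloisRep` (Deligne's `λ`-adic representations
  of a newform of weight `≥ 2`, Deligne–Serre 1974, Thm. 6.1),
* `Automorphic.edixhoven1992_serreWeight_le_weight_of_newform` (Edixhoven 1992, Thm. 4.5),
* `Automorphic.darmonDiamondTaylor1995_ordinary_of_weightTwo_newform_dvd_level`
  (Darmon–Diamond–Taylor 1995, Thm. 3.1 (g), p. 87).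

Everything else on the road is PROVED in the tree and used here: the passage «mod-`3` Hecke
eigen-system occurring in `H₁(X₀(L), ℤ)` ⇒ newform `g₀` of level `M ∣ L` with
`a_p(g₀) ≡ a_p (mod 𝔐)`» (`ModularSymbols.exists_isNewform0_of_genEigenvector_mod_three`,
`ModularSymbols.exists_maximal_ideal_over_ker`: Deligne–Serre 6.11, Eichler–Shimura by duality,
lying over), the `t`-norm transport `Nm Λ_N ↪ Λ_{N/3}`
(`ModularSymbols.exists_genEigenvector_level_div_three_of_normInt`), the mod-`𝔐` representation
of a newform from Thm. 6.1 (`DeligneSerre1974.exists_isGaloisRepOfNewform1Int_liftToGamma1_of_thm61`),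
Chebotarev + Brauer–Nesbitt without ramification hypotheses and finite separating sets of places
(`FramedGaloisRep.nonempty_equiv_of_hasFrobCharpolyAt_of_finite_of_discrete'`,
`FramedGaloisRep.exists_finset_forall_nonempty_equiv_of_hasFrobCharpolyAt`: Deligne–Serre
Lemme 3.2 and 8.6), the package `det ρ̄ = χ̄₃`, odd, absolutely irreducible, `det ρ̄|I₃ ≠ 1`, local
restriction datum (`ModPGaloisRep.*_of_frobCharpoly`), and the weight bound `k(ρ̄) ≤ p + 1` for
weight two and `ord_p(level) ≤ 1` (`Automorphic.serreWeight_le_add_one_of_weightTwo_newform`).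

## Main statements

* `exists_finset_congruence_newforms_of_modThree_rep` — **the arithmetic separating set.**  For
  `ρ̄ : Γ_ℚ → GL₂(𝔽₃)` irreducible with Frobenius polynomials `X² − a_p X + p` at the primes
  `p ∤ T` (`3 ∣ T`) and a level `L ∣ T`, there is a finite set `S₀` of primes `p ∤ T` such that
  for every newform `g₀` of weight `2` and level `M ∣ L` and every prime `𝔐 ∣ 3` of `𝓞_{K_{g₀}}`:
  `a_p(g₀) ≡ a_p (mod 𝔐)` for `p ∈ S₀` implies `a_p(g₀) ≡ a_p (mod 𝔐)` for ALL primes `p ∤ T`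
  (Deligne–Serre 8.6: finitely many `ρ̄_{g₀,𝔐} ⊗ 𝔽̄₃`, each semisimple, are separated from
  `ρ̄ ⊗ 𝔽̄₃` by finitely many Frobenius polynomials; conversely `ρ̄ ⊗ 𝔽̄₃ ≅ ρ̄_{g₀,𝔐} ⊗ 𝔽̄₃` gives all
  congruences).
* `serreWeight_le_four_of_genEigenvector_mod_three` — **level `L`, `9 ∤ L`.**  GRANTED the three
  facts: with `S₀` as above, if the system `(a_p mod 3)_{p ∈ S₀}` occurs in `Λ_L ⊗ 𝔽₃`
  (`Λ_L = H₁(X₀(L), ℤ)`: a joint generalised eigenvector `y ∈ Λ_L ∖ 3Λ_L`), then for every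
  algebraically closed discrete `k` of characteristic `3` and `j : 𝔽₃ → k` there are a local
  restriction datum `loc` at `3` and a residue embedding `ι` with `k(ρ̄ ⊗_j k) ≤ 4`.
* `serreWeight_le_four_of_normImage_mod_three` — **the norm image, `9 ∣ N`, `27 ∤ N`.**  GRANTED
  the three facts, the statement of `normImage_modThree_serreWeight_le_four` for the levels `N`
  with `27 ∤ N` (so that `9 ∤ N/3`), by the transport to level `N/3`.

READING NOTE on the named fact.  `normImage_modThree_serreWeight_le_four` carries only `9 ∣ N`,
while its printed assembly ("since `9 ∤ N/3`, `ρ_g|G₃` is finite flat or ordinary") uses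
`9 ∤ N/3`, i.e. `27 ∤ N`; for `27 ∣ N` a level-`N/3` newform can be supercuspidal at `3` with
`k(ρ̄) = 6` and nothing printed applies.  This file proves the `27 ∤ N` statement (which is what the
TQMP organ uses: there `N = 3·N_W` with `9 ∥ N_W`) and does not touch the named fact.

## References

* P. Deligne, J.-P. Serre, *Formes modulaires de poids 1*, Ann. Sci. ÉNS (4) 7 (1974): Lemme 3.2
  (p. 513), Thm. 6.1 (p. 520), Lemme 6.11, Thm. 6.7 and 8.6 (p. 526). [DeligneSerreASENS1974]
* H. Darmon, F. Diamond, R. Taylor, *Fermat's Last Theorem* (1995), Thm. 3.1 (a),(f),(g) (p. 86),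
  p. 87, Thm. 1.29. [DarmonDiamondTaylor1995]
* B. Edixhoven, *The weight in Serre's conjectures on modular forms*, Invent. Math. 109 (1992),
  Thm. 4.5. [Edixhoven1992]
* J.-P. Serre, *Sur les représentations modulaires de degré 2 de Gal(ℚ̄/ℚ)*, Duke Math. J. 54
  (1987), §§1.2, 2.2–2.4, (3.2.3). [Serre1987]
* M. F. Atiyah, I. G. Macdonald, *Introduction to Commutative Algebra* (1969), Thm. 5.10.
  [AtiyahMacdonald1969]
* F. Diamond, J. Shurman, *A first course in modular forms*, GTM 228 (2005), §4.3, Thm. 6.5.1,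
  Def. 9.6.4. [DiamondShurman2005]
-/

noncomputable section

open scoped MatrixGroups ModularForm NumberField Polynomial
open CongruenceSubgroup UpperHalfPlane IsDedekindDomain Polynomial Rat.HeightOneSpectrum Field ValuativeRel
open Literature.NumberTheory.GaloisRepresentations
open Literature.NumberTheory.GaloisRepresentations.IsNonarchimedeanLocalField

/-! ## § 1 Newform representations: transport along isomorphisms, coefficient fields, the Hecke
polynomial of the `Γ₁`-lift of a `Γ₀`-newform along an integral coefficient map -/

namespace Literature.NumberTheory.EllipticCurves.ModularForms

section Newform

variable {N : ℕ} [NeZero N] {k : ℤ}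

/-- **Being attached to `f` through `ι : 𝓞_f → A` is an invariant of the isomorphism class**:
unramifiedness and the characteristic polynomials of arithmetic Frobenii are
(`FramedGaloisRep.isUnramifiedAt_of_equiv`, `FramedGaloisRep.hasFrobCharpolyAt_of_equiv`;
Serre 1968, Ch. I §2.1, §2.3).  This is how a representation `ρ̄` KNOWN only through its
Frobenius polynomials acquires the predicate `IsGaloisRepOfNewform1Int f ι S ρ̄` once it is shown
isomorphic to the printed `ρ̄_{f,λ}` (Darmon–Diamond–Taylor p. 87). [cite: DeligneSerreASENS1974, §6 (Thm. 6.1, (6.1.1))] -/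
theorem IsGaloisRepOfNewform1Int.of_equiv {f : CuspForm (Gamma1 N) k} {A : Type*} [CommRing A]
    [TopologicalSpace A] [IsTopologicalRing A] {ι : coeffCharIntegers f →+* A} {S : Set ℕ}
    {ρ ρ' : FramedGaloisRep ℚ A 2} (h : IsGaloisRepOfNewform1Int f ι S ρ)
    (e : ContinuousRep.Equiv (FramedGaloisRep.toGaloisRep (K := ℚ) ρ)
      (FramedGaloisRep.toGaloisRep (K := ℚ) ρ')) :
    IsGaloisRepOfNewform1Int f ι S ρ' := by
  intro v hv
  obtain ⟨hur, P, hP, hchar⟩ := h v hv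
  exact ⟨FramedGaloisRep.isUnramifiedAt_of_equiv e hur, P, hP,
    FramedGaloisRep.hasFrobCharpolyAt_of_equiv e hchar⟩

variable {M : ℕ} [NeZero M]

/-- The `Γ₁(M)`-lift of a `Γ₀(M)`-form has the same Fourier coefficients
(`coe_liftToGamma1_holds`: the underlying function on `ℍ` is unchanged; Diamond–Shurman §4.3,
`S_k(Γ₀(M)) = S_k(M, 𝟙)`). [cite: DiamondShurman2005, §4.3 and §5.1 p. 166 case (1)] -/
theorem cuspCoeff_liftToGamma1_eq (g : CuspForm (Gamma0 M) k) (n : ℕ) :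
    cuspCoeff (liftToGamma1 M k g) n = cuspCoeff g n := by
  change (qExpansion 1 ⇑(liftToGamma1 M k g)).coeff n = (qExpansion 1 ⇑g).coeff n
  rw [coe_liftToGamma1_holds M k g]

/-- **`a_n(g₀)` is an algebraic integer of `K_{g₀}`** for a `Γ₀(M)`-newform `g₀` of weight `2`:
there is `r ∈ 𝓞_{K}`, `K = coeffCharField (liftToGamma1 M 2 g₀)`, with `r = a_n(g₀)` in `ℂ`
(Diamond–Shurman Thm. 6.5.1; the tree's `IsNewform1.isIntegral_cuspCoeff` with the discharged
Deligne–Serre (2.7.2) lattice fact). [cite: DiamondShurman2005, Thm. 6.5.1] [cite: DeligneSerreASENS1974, Prop. 2.7 (2.7.2)] -/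
theorem IsNewform0.exists_ringOfIntegers_coe_eq_cuspCoeff {g : CuspForm (Gamma0 M) 2}
    (hg : IsNewform0 g) (n : ℕ) :
    ∃ r : 𝓞 (coeffCharField (liftToGamma1 M 2 g)),
      ((r : coeffCharField (liftToGamma1 M 2 g)) : ℂ) = cuspCoeff g n := by
  have hf₁ : IsNewform1 (liftToGamma1 M 2 g) := (isNewform1_liftToGamma1_iff_holds M 2 g).mpr hg
  have hint : IsIntegral ℤ (cuspCoeff (liftToGamma1 M 2 g) n) :=
    IsNewform1.isIntegral_cuspCoeff (DeligneSerre1974_span_integralLattice1_holds M 2)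
      (by norm_num) hf₁ n
  refine ⟨⟨⟨cuspCoeff (liftToGamma1 M 2 g) n, cuspCoeff_mem_coeffCharField _ n⟩,
    (isIntegral_coeffCharField_iff _).mpr hint⟩, ?_⟩
  change cuspCoeff (liftToGamma1 M 2 g) n = cuspCoeff g n
  exact cuspCoeff_liftToGamma1_eq g n

/-- **The integral Hecke polynomial of the lift of a `Γ₀(M)`-newform of weight `2` at a prime
`p ∤ M` is `X² − a_p X + p`.**  If `P ∈ 𝓞_K[X]` maps to the Hecke polynomial
`X² − a_p X + ε(p) p ∈ K[X]` of `f₁ = liftToGamma1 M 2 g₀` (`ε = nebentypus f₁ = 𝟙`,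
`nebentypus_liftToGamma1_holds`; `ε(p) = 1` as `p ∤ M`) and `r ∈ 𝓞_K` is `a_p(g₀)`, then
`P = X² − r X + p` (`𝓞_K → K → ℂ` is injective). [cite: DeligneSerreASENS1974, Thm. 6.1, (6.1.1) (p. 520)] [cite: DiamondShurman2005, §4.3 (S_k(Γ₀(N)) = S_k(N, 𝟙))] -/
theorem IsNewform0.eq_of_map_eq_heckePolynomial_liftToGamma1 {g : CuspForm (Gamma0 M) 2}
    (hg : IsNewform0 g) {p : ℕ} (hp : p.Prime) (hpM : ¬ p ∣ M)
    {P : Polynomial (coeffCharIntegers (liftToGamma1 M 2 g))}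
    (hP : P.map (algebraMap (coeffCharIntegers (liftToGamma1 M 2 g))
        (coeffCharField (liftToGamma1 M 2 g))) = heckePolynomial (liftToGamma1 M 2 g) p)
    {r : coeffCharIntegers (liftToGamma1 M 2 g)}
    (hr : ((r : coeffCharField (liftToGamma1 M 2 g)) : ℂ) = cuspCoeff g p) :
    P = X ^ 2 - C r * X + C (p : coeffCharIntegers (liftToGamma1 M 2 g)) := by
  have hε : nebentypus (liftToGamma1 M 2 g) = 1 := nebentypus_liftToGamma1_holds M 2 hg.ne_zero
  have hunit : IsUnit ((p : ℕ) : ZMod M) := (ZMod.isUnit_prime_iff_not_dvd hp).mpr hpM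
  apply Polynomial.map_injective (algebraMap (coeffCharIntegers (liftToGamma1 M 2 g))
    (coeffCharField (liftToGamma1 M 2 g))) (fun x y h ↦ Subtype.ext h)
  apply Polynomial.map_injective (algebraMap (coeffCharField (liftToGamma1 M 2 g)) ℂ)
    (algebraMap (coeffCharField (liftToGamma1 M 2 g)) ℂ).injective
  rw [hP, map_heckePolynomial]
  simp only [Polynomial.map_add, Polynomial.map_sub, Polynomial.map_mul, Polynomial.map_pow,
    Polynomial.map_X, Polynomial.map_C]
  have h1 : algebraMap (coeffCharField (liftToGamma1 M 2 g)) ℂ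
      (algebraMap (coeffCharIntegers (liftToGamma1 M 2 g)) (coeffCharField (liftToGamma1 M 2 g)) r) =
      (qExpansion 1 ⇑(liftToGamma1 M 2 g)).coeff p := by
    change ((r : coeffCharField (liftToGamma1 M 2 g)) : ℂ) = cuspCoeff (liftToGamma1 M 2 g) p
    rw [hr, cuspCoeff_liftToGamma1_eq]
  have h2 : algebraMap (coeffCharField (liftToGamma1 M 2 g)) ℂ
      (algebraMap (coeffCharIntegers (liftToGamma1 M 2 g)) (coeffCharField (liftToGamma1 M 2 g))
        (p : coeffCharIntegers (liftToGamma1 M 2 g))) =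
      (nebentypus (liftToGamma1 M 2 g) (p : ZMod M) : ℂ) * (p : ℂ) ^ ((2 : ℤ) - 1) := by
    rw [map_natCast, map_natCast, hε, MulChar.one_apply hunit, one_mul]
    norm_num
  rw [h1, h2]

/-- The same along any coefficient map `ι : 𝓞_K → κ`: `ι(P) = X² − ι(a_p) X + p`.
[cite: DeligneSerreASENS1974, Thm. 6.1, (6.1.1) (p. 520)] -/
theorem IsNewform0.map_eq_of_map_eq_heckePolynomial_liftToGamma1 {g : CuspForm (Gamma0 M) 2}
    (hg : IsNewform0 g) {p : ℕ} (hp : p.Prime) (hpM : ¬ p ∣ M)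
    {P : Polynomial (coeffCharIntegers (liftToGamma1 M 2 g))}
    (hP : P.map (algebraMap (coeffCharIntegers (liftToGamma1 M 2 g))
        (coeffCharField (liftToGamma1 M 2 g))) = heckePolynomial (liftToGamma1 M 2 g) p)
    {r : coeffCharIntegers (liftToGamma1 M 2 g)}
    (hr : ((r : coeffCharField (liftToGamma1 M 2 g)) : ℂ) = cuspCoeff g p)
    {κ : Type*} [CommRing κ] (ι : coeffCharIntegers (liftToGamma1 M 2 g) →+* κ) :
    P.map ι = X ^ 2 - C (ι r) * X + C (p : κ) := by
  rw [hg.eq_of_map_eq_heckePolynomial_liftToGamma1 hp hpM hP hr]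
  simp only [Polynomial.map_add, Polynomial.map_sub, Polynomial.map_mul, Polynomial.map_pow,
    Polynomial.map_X, Polynomial.map_C]
  rw [map_natCast ι]

end Newform

end Literature.NumberTheory.EllipticCurves.ModularForms

namespace Literature.NumberTheory.EllipticCurves

open Literature.NumberTheory.EllipticCurves.ModularForms Literature.NumberTheory.ModularSymbols

/-! ## § 2 Reductions `𝓞_K → k` with prescribed kernel; finiteness of the places above `3` -/

section Reduction

/-- **A reduction map with prescribed kernel.**  For a finite place `v` of a number field `K`
above the rational prime `ℓ` and an algebraically closed field `k` of characteristic `ℓ` there is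
a ring homomorphism `ι : 𝓞_K → k` with `ker ι = v`: `𝓞_K / v` is a finite field of
characteristic `ℓ` (Mathlib `Ideal.finiteQuotientOfFreeOfNeBot`), hence algebraic over `𝔽_ℓ`,
and embeds into `k` (`IsAlgClosed.lift`); compose with the quotient map.  This is the map
`a ↦ ā` "réduction modulo une place de `ℚ̄` au-dessus de `ℓ`" of Deligne–Serre 6.7 / Serre
(3.2.3). [cite: DeligneSerreASENS1974, Thm. 6.7 (p. 521)] [cite: Serre1987, (3.2.3)] -/
theorem exists_ringHom_ringOfIntegers_ker_eq (K : Type*) [Field K] [NumberField K]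
    (v : HeightOneSpectrum (𝓞 K)) {ℓ : ℕ} (hℓ : ℓ.Prime) (hℓv : (ℓ : 𝓞 K) ∈ v.asIdeal)
    (k : Type*) [Field k] [CharP k ℓ] [IsAlgClosed k] :
    ∃ ι : 𝓞 K →+* k, ∀ x, ι x = 0 ↔ x ∈ v.asIdeal := by
  haveI : Fact ℓ.Prime := ⟨hℓ⟩
  haveI : v.asIdeal.IsMaximal := v.isPrime.isMaximal v.ne_bot
  letI : Field (𝓞 K ⧸ v.asIdeal) := Ideal.Quotient.field v.asIdeal
  haveI : CharP (𝓞 K ⧸ v.asIdeal) ℓ :=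
    (CharP.charP_iff_prime_eq_zero hℓ).mpr (by
      rw [← map_natCast (Ideal.Quotient.mk v.asIdeal), Ideal.Quotient.eq_zero_iff_mem]
      exact hℓv)
  haveI : Finite (𝓞 K ⧸ v.asIdeal) := Ideal.finiteQuotientOfFreeOfNeBot v.asIdeal v.ne_bot
  letI : Algebra (ZMod ℓ) (𝓞 K ⧸ v.asIdeal) := ZMod.algebra _ ℓ
  letI : Algebra (ZMod ℓ) k := ZMod.algebra _ ℓ
  haveI : Algebra.IsAlgebraic (ZMod ℓ) (𝓞 K ⧸ v.asIdeal) := Algebra.IsAlgebraic.of_finite _ _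
  -- vector spaces are torsion-free (stated by hand: the generic instances are not found in time)
  haveI : Module.IsTorsionFree (ZMod ℓ) (𝓞 K ⧸ v.asIdeal) :=
    .of_smul_eq_zero fun r m h => by
      by_cases hr : r = 0
      · exact Or.inl hr
      · exact Or.inr (by rw [← inv_smul_smul₀ hr m, h, smul_zero])
  haveI : Module.IsTorsionFree (ZMod ℓ) k :=
    .of_smul_eq_zero fun r m h => by
      by_cases hr : r = 0
      · exact Or.inl hr
      · exact Or.inr (by rw [← inv_smul_smul₀ hr m, h, smul_zero])
  let ψ := IsAlgClosed.lift (R := ZMod ℓ) (M := k) (S := 𝓞 K ⧸ v.asIdeal)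
  refine ⟨ψ.toRingHom.comp (Ideal.Quotient.mk v.asIdeal), fun x ↦ ?_⟩
  rw [RingHom.comp_apply, ← Ideal.Quotient.eq_zero_iff_mem]
  exact map_eq_zero_iff _ ψ.toRingHom.injective

/-- A number field has finitely many places above `3`: the prime factors of the non-zero ideal
`3𝓞_K` of the Dedekind domain `𝓞_K` (Mathlib `Ideal.finite_factors`).
[cite: AtiyahMacdonald1969, Ch. 9, Cor. 9.4 (p. 95)] -/
theorem finite_heightOneSpectrum_three_mem (K : Type*) [Field K] [NumberField K] :
    Finite {w : HeightOneSpectrum (𝓞 K) // ((3 : ℕ) : 𝓞 K) ∈ w.asIdeal} := by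
  have h3 : (Ideal.span {((3 : ℕ) : 𝓞 K)} : Ideal (𝓞 K)) ≠ 0 := by
    rw [Ne, Ideal.zero_eq_bot, Ideal.span_singleton_eq_bot]
    exact_mod_cast (by norm_num : (3 : ℕ) ≠ 0)
  exact ((Ideal.finite_factors h3).subset fun w hw ↦ Ideal.dvd_span_singleton.mpr hw).to_subtype

/-- The finite places of `ℚ` dividing a non-zero `T` form a finite set. [folklore] -/
private theorem finite_heightOneSpectrum_rat_dvd' {T : ℕ} (hT : T ≠ 0) :
    {v : HeightOneSpectrum (𝓞 ℚ) | ((primesEquiv v : Nat.Primes) : ℕ) ∣ T}.Finite := by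
  have hfin : {n : ℕ | n ∣ T}.Finite :=
    T.divisors.finite_toSet.subset fun n hn ↦ Nat.mem_divisors.mpr ⟨hn, hT⟩
  exact (hfin.preimage (f := fun v : HeightOneSpectrum (𝓞 ℚ) ↦ ((primesEquiv v : Nat.Primes) : ℕ))
    fun _ _ _ _ h ↦ primesEquiv.injective (Subtype.ext h)).subset fun v hv ↦ hv

end Reduction

/-! ## § 3 Mod-`3` systems `X² − a_p X + p`: Frobenius polynomials shared with newform
representations, and the arithmetic separating set (Deligne–Serre 8.6) -/

section Separation

/-- The Frobenius polynomial of `ρ̄ ⊗_j κ` at a place `v ∤ T`: `X² − a_p X + p` read in `κ`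
(`FramedGaloisRep.hasFrobCharpolyAt_baseChange`). [cite: Serre1987, §1.2 and (3.2.3)] -/
theorem hasFrobCharpolyAt_baseChange_of_frobCharpoly (ρ : ModPGaloisRep ℚ (ZMod 3) 2) {T : ℕ}
    (a : ℕ → ℤ)
    (htr : ∀ (v : HeightOneSpectrum (𝓞 ℚ)), ¬ ((primesEquiv v : Nat.Primes) : ℕ) ∣ T →
      ∀ 𝔓 ∈ v.primesAbove, ∀ φ : absoluteGaloisGroup ℚ, IsArithFrobAt (𝓞 ℚ) φ 𝔓 →
        ((ρ φ : GL (Fin 2) (ZMod 3)) : Matrix (Fin 2) (Fin 2) (ZMod 3)).charpoly =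
          X ^ 2 - C ((a ((primesEquiv v : Nat.Primes) : ℕ) : ℤ) : ZMod 3) * X +
            C ((((primesEquiv v : Nat.Primes) : ℕ) : ℕ) : ZMod 3))
    {κ : Type*} [CommRing κ] [TopologicalSpace κ] (j : ZMod 3 →+* κ) (hj : Continuous j)
    (v : HeightOneSpectrum (𝓞 ℚ)) (hvT : ¬ ((primesEquiv v : Nat.Primes) : ℕ) ∣ T) :
    FramedGaloisRep.HasFrobCharpolyAt v
      (X ^ 2 - C ((a ((primesEquiv v : Nat.Primes) : ℕ) : ℤ) : κ) * X +
        C ((((primesEquiv v : Nat.Primes) : ℕ) : ℕ) : κ)) (FramedRep.baseChange j hj ρ) := by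
  have hρv : FramedGaloisRep.HasFrobCharpolyAt v
      (X ^ 2 - C ((a ((primesEquiv v : Nat.Primes) : ℕ) : ℤ) : ZMod 3) * X +
        C ((((primesEquiv v : Nat.Primes) : ℕ) : ℕ) : ZMod 3)) ρ :=
    fun 𝔓 h𝔓 σ hσ ↦ htr v hvT 𝔓 h𝔓 σ hσ
  have h := FramedGaloisRep.hasFrobCharpolyAt_baseChange j hj hρv
  simp only [Polynomial.map_add, Polynomial.map_sub, Polynomial.map_mul, Polynomial.map_pow,
    Polynomial.map_X, Polynomial.map_C] at h
  rw [map_intCast j, map_natCast j] at h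
  exact h

/-- **A congruence `a_p(g₀) ≡ a_p (mod ker ι)` gives a common Frobenius polynomial at `p`** of
`ρ̄ ⊗_j κ` and any `ρ'` attached to `f₁ = liftToGamma1 M 2 g₀` through `ι : 𝓞_{K} → κ`
(`p ∤ T M`, `p ∉ S`): both are `X² − a_p X + p ∈ κ[X]` (`eq_of_map_eq_heckePolynomial_liftToGamma1`,
Darmon–Diamond–Taylor Thm. 3.1 (a): `tr ρ̄_{g₀}(Frob_p) = a_p(g₀)`, `det = p`).
[cite: DarmonDiamondTaylor1995, Thm. 3.1 (a) (p. 86) and p. 87] -/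
theorem exists_common_hasFrobCharpolyAt_of_congr (ρ : ModPGaloisRep ℚ (ZMod 3) 2) {T : ℕ}
    (a : ℕ → ℤ)
    (htr : ∀ (v : HeightOneSpectrum (𝓞 ℚ)), ¬ ((primesEquiv v : Nat.Primes) : ℕ) ∣ T →
      ∀ 𝔓 ∈ v.primesAbove, ∀ φ : absoluteGaloisGroup ℚ, IsArithFrobAt (𝓞 ℚ) φ 𝔓 →
        ((ρ φ : GL (Fin 2) (ZMod 3)) : Matrix (Fin 2) (Fin 2) (ZMod 3)).charpoly =
          X ^ 2 - C ((a ((primesEquiv v : Nat.Primes) : ℕ) : ℤ) : ZMod 3) * X +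
            C ((((primesEquiv v : Nat.Primes) : ℕ) : ℕ) : ZMod 3))
    {M : ℕ} [NeZero M] {g : CuspForm (Gamma0 M) 2} (hg : IsNewform0 g)
    {κ : Type*} [Field κ] [TopologicalSpace κ] (j : ZMod 3 →+* κ) (hj : Continuous j)
    (ι : coeffCharIntegers (liftToGamma1 M 2 g) →+* κ) {S : Set ℕ} {ρ' : FramedGaloisRep ℚ κ 2}
    (hρ' : IsGaloisRepOfNewform1Int (liftToGamma1 M 2 g) ι S ρ')
    (v : HeightOneSpectrum (𝓞 ℚ)) (hvT : ¬ ((primesEquiv v : Nat.Primes) : ℕ) ∣ T)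
    (hvS : ((primesEquiv v : Nat.Primes) : ℕ) ∉ S) (hvM : ¬ ((primesEquiv v : Nat.Primes) : ℕ) ∣ M)
    {r : 𝓞 (coeffCharField (liftToGamma1 M 2 g))}
    (hr : ((r : coeffCharField (liftToGamma1 M 2 g)) : ℂ) =
      cuspCoeff g ((primesEquiv v : Nat.Primes) : ℕ))
    (hιr : ι r = ((a ((primesEquiv v : Nat.Primes) : ℕ) : ℤ) : κ)) :
    ∃ P : κ[X], FramedGaloisRep.HasFrobCharpolyAt v P ρ' ∧
      FramedGaloisRep.HasFrobCharpolyAt v P (FramedRep.baseChange j hj ρ) := by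
  have hp : ((primesEquiv v : Nat.Primes) : ℕ).Prime := (primesEquiv v).2
  obtain ⟨-, P, hP, hchar⟩ := hρ' v hvS
  have hPι : P.map ι = X ^ 2 - C (ι r) * X + C (((primesEquiv v : Nat.Primes) : ℕ) : κ) :=
    hg.map_eq_of_map_eq_heckePolynomial_liftToGamma1 hp hvM hP hr ι
  refine ⟨_, ?_, hasFrobCharpolyAt_baseChange_of_frobCharpoly ρ a htr j hj v hvT⟩
  rw [← hιr, ← hPι]
  exact hchar

/-- In a commutative ring, `X² − bX + c = X² − b'X + c'` forces `b = b'` (coefficient of `X`).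
[folklore] -/
private theorem eq_of_quadratic_eq' {R : Type*} [CommRing R] {b b' c c' : R}
    (h : (X ^ 2 - C b * X + C c : R[X]) = X ^ 2 - C b' * X + C c') : b = b' := by
  have h1 := congrArg (fun P : R[X] ↦ P.coeff 1) h
  simp only [coeff_add, coeff_sub, coeff_X_pow, coeff_C_mul, coeff_X_one, coeff_C,
    mul_one] at h1
  simpa using h1

/-- **An isomorphism `ρ̄ ⊗_j κ ≅ ρ'` with `ρ'` attached to `f₁ = liftToGamma1 M 2 g₀` through
`ι : 𝓞_K → κ` forces `ι(a_p(g₀)) = a_p` in `κ` at every prime `p ∤ T M`, `p ∉ S`**: the Frobenius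
polynomial `X² − a_p X + p` of `ρ̄ ⊗ κ` is transported to `ρ'` (`hasFrobCharpolyAt_of_equiv`) and
compared with `ι(X² − a_p(g₀) X + p)` (`HasFrobCharpolyAt.unique`); read off the coefficient of
`X` (Deligne–Serre 6.7: "`Tr(F_{ℓ,p}) ≡ a_p`"; Darmon–Diamond–Taylor Thm. 3.1 (a), p. 87).
[cite: DeligneSerreASENS1974, Thm. 6.7 (p. 521)] [cite: DarmonDiamondTaylor1995, Thm. 3.1 (a) (p. 86) and p. 87] -/
theorem ringHom_apply_eq_of_equiv_of_frobCharpoly (ρ : ModPGaloisRep ℚ (ZMod 3) 2) {T : ℕ}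
    (a : ℕ → ℤ)
    (htr : ∀ (v : HeightOneSpectrum (𝓞 ℚ)), ¬ ((primesEquiv v : Nat.Primes) : ℕ) ∣ T →
      ∀ 𝔓 ∈ v.primesAbove, ∀ φ : absoluteGaloisGroup ℚ, IsArithFrobAt (𝓞 ℚ) φ 𝔓 →
        ((ρ φ : GL (Fin 2) (ZMod 3)) : Matrix (Fin 2) (Fin 2) (ZMod 3)).charpoly =
          X ^ 2 - C ((a ((primesEquiv v : Nat.Primes) : ℕ) : ℤ) : ZMod 3) * X +
            C ((((primesEquiv v : Nat.Primes) : ℕ) : ℕ) : ZMod 3))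
    {M : ℕ} [NeZero M] {g : CuspForm (Gamma0 M) 2} (hg : IsNewform0 g)
    {κ : Type*} [Field κ] [TopologicalSpace κ] [IsTopologicalRing κ] (j : ZMod 3 →+* κ)
    (hj : Continuous j) (ι : coeffCharIntegers (liftToGamma1 M 2 g) →+* κ) {S : Set ℕ}
    {ρ' : FramedGaloisRep ℚ κ 2} (hρ' : IsGaloisRepOfNewform1Int (liftToGamma1 M 2 g) ι S ρ')
    (e : ContinuousRep.Equiv (FramedGaloisRep.toGaloisRep (K := ℚ) (FramedRep.baseChange j hj ρ))
      (FramedGaloisRep.toGaloisRep (K := ℚ) ρ'))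
    (v : HeightOneSpectrum (𝓞 ℚ)) (hvT : ¬ ((primesEquiv v : Nat.Primes) : ℕ) ∣ T)
    (hvS : ((primesEquiv v : Nat.Primes) : ℕ) ∉ S) (hvM : ¬ ((primesEquiv v : Nat.Primes) : ℕ) ∣ M)
    {r : 𝓞 (coeffCharField (liftToGamma1 M 2 g))}
    (hr : ((r : coeffCharField (liftToGamma1 M 2 g)) : ℂ) =
      cuspCoeff g ((primesEquiv v : Nat.Primes) : ℕ)) :
    ι r = ((a ((primesEquiv v : Nat.Primes) : ℕ) : ℤ) : κ) := by
  have hp : ((primesEquiv v : Nat.Primes) : ℕ).Prime := (primesEquiv v).2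
  obtain ⟨-, P, hP, hchar⟩ := hρ' v hvS
  have hPι : P.map ι = X ^ 2 - C (ι r) * X + C (((primesEquiv v : Nat.Primes) : ℕ) : κ) :=
    hg.map_eq_of_map_eq_heckePolynomial_liftToGamma1 hp hvM hP hr ι
  have hρv := hasFrobCharpolyAt_baseChange_of_frobCharpoly ρ a htr j hj v hvT
  have heq : X ^ 2 - C (ι r) * X + C (((primesEquiv v : Nat.Primes) : ℕ) : κ) =
      X ^ 2 - C ((a ((primesEquiv v : Nat.Primes) : ℕ) : ℤ) : κ) * X +
        C (((primesEquiv v : Nat.Primes) : ℕ) : κ) := by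
    rw [← hPι]
    exact FramedGaloisRep.HasFrobCharpolyAt.unique hchar
      (FramedGaloisRep.hasFrobCharpolyAt_of_equiv e hρv)
  exact eq_of_quadratic_eq' heq

set_option maxHeartbeats 800000 in
/-- **The arithmetic separating set** (Deligne–Serre 1974, 8.6: "il existe un ensemble fini `X`
de nombres premiers … tel que …", via Lemme 3.2 = Chebotarev + Brauer–Nesbitt), GRANTED
Deligne's Thm. 6.1.  Let `ρ̄ : Γ_ℚ → GL₂(𝔽₃)` be continuous and irreducible (no stable line) with
`charpoly ρ̄(Frob_p) = X² − a_p X + p` at every prime `p ∤ T` (`T ≠ 0`, `3 ∣ T`), and let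
`L ∣ T`.  There is a finite set `S₀` of primes `p ∤ T` such that for every level `M ∣ L`, every
newform `g₀ ∈ S₂(Γ₀(M))` and every prime `w ∋ 3` of `𝓞_K`, `K = K_{g₀}` (with character values):
if `a_p(g₀) ≡ a_p (mod w)` for all `p ∈ S₀`, then `a_p(g₀) ≡ a_p (mod w)` for ALL primes
`p ∤ T`.  Proof: over `k₀ = 𝔽̄₃` (discrete) the representation `ρ̄ ⊗ k₀` is irreducible, hence
semisimple (`ModPGaloisRep.isIrreducible_baseChange_of_frobCharpoly`); the triples `(M, g₀, w)` are
finitely many (`finite_newforms0_holds`, `Ideal.finite_factors`) and each carries the semisimple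
`ρ̄_{g₀,w} ⊗ k₀` of Thm. 6.1 + 6.12 along a reduction `𝓞_K → k₀` with kernel `w`
(`exists_isGaloisRepOfNewform1Int_liftToGamma1_of_thm61`, `exists_ringHom_ringOfIntegers_ker_eq`);
take for `S₀` the primes under a separating set of places outside `{v ∣ T}`
(`exists_finset_forall_nonempty_equiv_of_hasFrobCharpolyAt`).  Congruences on `S₀` are common
Frobenius polynomials there, whence `ρ̄ ⊗ k₀ ≅ ρ̄_{g₀,w} ⊗ k₀`, whence equal Frobenius polynomials at
every `p ∤ T` (`HasFrobCharpolyAt.unique`), i.e. `ā_p(g₀) = ā_p` in `k₀`.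
[cite: DeligneSerreASENS1974, Lemme 3.2 (p. 513), Thm. 6.7 and 8.6 (p. 526)]
[cite: DarmonDiamondTaylor1995, Thm. 3.1 (a) (p. 86) and p. 87] -/
theorem exists_finset_congruence_newforms_of_modThree_rep
    (h61 : DeligneSerre1974.thm61_exists_adicGaloisRep)
    (ρ : ModPGaloisRep ℚ (ZMod 3) 2)
    (hirr : ∀ L : Submodule (ZMod 3) (Fin 2 → ZMod 3),
      (∀ (g : absoluteGaloisGroup ℚ) (x : Fin 2 → ZMod 3), x ∈ L →
        ((ρ g : GL (Fin 2) (ZMod 3)) : Matrix (Fin 2) (Fin 2) (ZMod 3)).mulVec x ∈ L) →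
        L = ⊥ ∨ L = ⊤)
    {T : ℕ} (hT : T ≠ 0) (h3T : 3 ∣ T) (a : ℕ → ℤ)
    (htr : ∀ (v : HeightOneSpectrum (𝓞 ℚ)), ¬ ((primesEquiv v : Nat.Primes) : ℕ) ∣ T →
      ∀ 𝔓 ∈ v.primesAbove, ∀ φ : absoluteGaloisGroup ℚ, IsArithFrobAt (𝓞 ℚ) φ 𝔓 →
        ((ρ φ : GL (Fin 2) (ZMod 3)) : Matrix (Fin 2) (Fin 2) (ZMod 3)).charpoly =
          X ^ 2 - C ((a ((primesEquiv v : Nat.Primes) : ℕ) : ℤ) : ZMod 3) * X +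
            C ((((primesEquiv v : Nat.Primes) : ℕ) : ℕ) : ZMod 3))
    (L : ℕ) [NeZero L] (hLT : L ∣ T) :
    ∃ S₀ : Finset ℕ, (∀ p ∈ S₀, p.Prime ∧ ¬ p ∣ T) ∧
      ∀ (M : ℕ) [NeZero M], M ∣ L → ∀ (g : CuspForm (Gamma0 M) 2), IsNewform0 g →
        ∀ w : HeightOneSpectrum (𝓞 (coeffCharField (liftToGamma1 M 2 g))),
          ((3 : ℕ) : 𝓞 (coeffCharField (liftToGamma1 M 2 g))) ∈ w.asIdeal →
          (∀ p ∈ S₀, ∃ r : 𝓞 (coeffCharField (liftToGamma1 M 2 g)),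
              ((r : coeffCharField (liftToGamma1 M 2 g)) : ℂ) = cuspCoeff g p ∧
                r - (a p : 𝓞 (coeffCharField (liftToGamma1 M 2 g))) ∈ w.asIdeal) →
          ∀ p : ℕ, p.Prime → ¬ p ∣ T → ∃ r : 𝓞 (coeffCharField (liftToGamma1 M 2 g)),
              ((r : coeffCharField (liftToGamma1 M 2 g)) : ℂ) = cuspCoeff g p ∧
                r - (a p : 𝓞 (coeffCharField (liftToGamma1 M 2 g))) ∈ w.asIdeal := by
  classical
  -- ### `k₀ = 𝔽̄₃` (discrete) and `ρ₀ = ρ̄ ⊗ k₀`, irreducible hence semisimple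
  let k₀ : Type := AlgebraicClosure (ZMod 3)
  letI : TopologicalSpace k₀ := ⊥
  haveI : DiscreteTopology k₀ := ⟨rfl⟩
  let j₀ : ZMod 3 →+* k₀ := algebraMap (ZMod 3) k₀
  have hj₀ : Continuous j₀ := continuous_of_discreteTopology
  let ρ₀ : FramedGaloisRep ℚ k₀ 2 := FramedRep.baseChange j₀ hj₀ ρ
  have hirr₀ : (FramedGaloisRep.toGaloisRep (K := ℚ) ρ₀).IsIrreducible :=
    ModPGaloisRep.isIrreducible_baseChange_of_frobCharpoly (by decide) ρ hirr hT h3T a htr j₀ hj₀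
  have hss₀ : (FramedGaloisRep.toGaloisRep (K := ℚ) ρ₀).IsSemisimple := by
    haveI : Representation.IsIrreducible
        (FramedGaloisRep.toGaloisRep (K := ℚ) ρ₀).toRepresentation := hirr₀
    change ComplementedLattice _
    infer_instance
  -- ### the finite index: levels `d ∣ L`, newforms `g` of level `d`, primes `w ∋ 3` of `𝓞_{K_g}`
  haveI hne : ∀ d : {d : ℕ // d ∈ L.divisors}, NeZero (d : ℕ) :=
    fun d ↦ ⟨(Nat.pos_of_mem_divisors d.2).ne'⟩
  let I : Type := Σ d : {d : ℕ // d ∈ L.divisors}, Σ g : ↥(newforms0 (d : ℕ) 2),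
    {w : HeightOneSpectrum (𝓞 (coeffCharField (liftToGamma1 (d : ℕ) 2
      (g : CuspForm (Gamma0 (d : ℕ)) 2)))) //
        ((3 : ℕ) : 𝓞 (coeffCharField (liftToGamma1 (d : ℕ) 2
          (g : CuspForm (Gamma0 (d : ℕ)) 2)))) ∈ w.asIdeal}
  haveI : Finite I := by
    haveI : ∀ d : {d : ℕ // d ∈ L.divisors}, Finite ↥(newforms0 (d : ℕ) 2) :=
      fun d ↦ (finite_newforms0_holds (d : ℕ) 2).to_subtype
    haveI : ∀ (d : {d : ℕ // d ∈ L.divisors}) (g : ↥(newforms0 (d : ℕ) 2)),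
        Finite {w : HeightOneSpectrum (𝓞 (coeffCharField (liftToGamma1 (d : ℕ) 2
          (g : CuspForm (Gamma0 (d : ℕ)) 2)))) //
            ((3 : ℕ) : 𝓞 (coeffCharField (liftToGamma1 (d : ℕ) 2
              (g : CuspForm (Gamma0 (d : ℕ)) 2)))) ∈ w.asIdeal} := fun d g ↦ by
      haveI := GreenbergSelmer.numberField_coeffCharField_liftToGamma1 (M := (d : ℕ)) (k := 2) g.2
      exact finite_heightOneSpectrum_three_mem _
    infer_instance
  -- ### per triple `(d, g, w)`: a reduction `𝓞_K → k₀` with kernel `w`, and the semisimple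
  -- representation of Thm. 6.1 + 6.12 along it
  have hι : ∀ (d : ℕ) [NeZero d] (g : CuspForm (Gamma0 d) 2), IsNewform0 g →
      ∀ w : HeightOneSpectrum (𝓞 (coeffCharField (liftToGamma1 d 2 g))),
        ((3 : ℕ) : 𝓞 (coeffCharField (liftToGamma1 d 2 g))) ∈ w.asIdeal →
        ∃ ι : 𝓞 (coeffCharField (liftToGamma1 d 2 g)) →+* k₀, ∀ x, ι x = 0 ↔ x ∈ w.asIdeal := by
    intro d _ g hg w hw
    haveI := GreenbergSelmer.numberField_coeffCharField_liftToGamma1 hg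
    exact exists_ringHom_ringOfIntegers_ker_eq _ w Nat.prime_three hw k₀
  choose ι hι using hι
  have hρ' : ∀ (d : ℕ) [NeZero d] (g : CuspForm (Gamma0 d) 2) (hg : IsNewform0 g)
      (w : HeightOneSpectrum (𝓞 (coeffCharField (liftToGamma1 d 2 g))))
      (hw : ((3 : ℕ) : 𝓞 (coeffCharField (liftToGamma1 d 2 g))) ∈ w.asIdeal),
      ∃ ρ' : FramedGaloisRep ℚ k₀ 2,
        IsGaloisRepOfNewform1Int (liftToGamma1 d 2 g) (ι d g hg w hw) {p | p ∣ d * 3} ρ' ∧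
          (FramedGaloisRep.toGaloisRep (K := ℚ) ρ').IsSemisimple := by
    intro d _ g hg w hw
    exact DeligneSerre1974.exists_isGaloisRepOfNewform1Int_liftToGamma1_of_thm61 h61
      (by norm_num) hg 3 (ι d g hg w hw)
  choose ρ' hρ' hρ'ss using hρ'
  -- ### a separating set of places outside `{v ∣ T}` (Deligne–Serre Lemme 3.2 / 8.6)
  obtain ⟨S₀', hS₀'T, hsep⟩ :=
    FramedGaloisRep.exists_finset_forall_nonempty_equiv_of_hasFrobCharpolyAt
      (finite_heightOneSpectrum_rat_dvd' hT) ρ₀ hss₀ (I := I)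
      (fun τ ↦ ρ' (τ.1 : ℕ) (τ.2.1 : CuspForm (Gamma0 (τ.1 : ℕ)) 2) τ.2.1.2 τ.2.2.1 τ.2.2.2)
      (fun τ ↦ hρ'ss _ _ _ _ _)
  refine ⟨S₀'.image (fun v ↦ ((primesEquiv v : Nat.Primes) : ℕ)), ?_, ?_⟩
  · intro p hp
    obtain ⟨v, hv, rfl⟩ := Finset.mem_image.mp hp
    exact ⟨(primesEquiv v).2, hS₀'T v hv⟩
  · intro M _ hML g hg w h3w hS₀ p hp hpT
    have hdM : M ∈ L.divisors := Nat.mem_divisors.mpr ⟨hML, NeZero.ne L⟩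
    have hnotS : ∀ q : ℕ, q.Prime → ¬ q ∣ T → q ∉ {q | q ∣ M * 3} := by
      intro q hq hqT h
      rcases (Nat.Prime.dvd_mul hq).mp h with h | h
      · exact hqT (h.trans (hML.trans hLT))
      · exact hqT (((Nat.prime_dvd_prime_iff_eq hq Nat.prime_three).mp h) ▸ h3T)
    -- congruences on `S₀` are common Frobenius polynomials on `S₀'`, whence `ρ₀ ≅ ρ'`
    have hcommon : ∀ v ∈ S₀', ∃ P : k₀[X], FramedGaloisRep.HasFrobCharpolyAt v P ρ₀ ∧
        FramedGaloisRep.HasFrobCharpolyAt v P (ρ' M g hg w h3w) := by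
      intro v hv
      have hvT : ¬ ((primesEquiv v : Nat.Primes) : ℕ) ∣ T := hS₀'T v hv
      obtain ⟨r, hr, hrw⟩ := hS₀ _ (Finset.mem_image.mpr ⟨v, hv, rfl⟩)
      have hvM : ¬ ((primesEquiv v : Nat.Primes) : ℕ) ∣ M :=
        fun h ↦ hvT (h.trans (hML.trans hLT))
      have hra : ι M g hg w h3w r = ((a ((primesEquiv v : Nat.Primes) : ℕ) : ℤ) : k₀) := by
        have h := (hι M g hg w h3w _).mpr hrw
        rwa [map_sub, map_intCast, sub_eq_zero] at h
      obtain ⟨P, h1, h2⟩ := exists_common_hasFrobCharpolyAt_of_congr ρ a htr hg j₀ hj₀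
        (ι M g hg w h3w) (hρ' M g hg w h3w) v hvT (hnotS _ (primesEquiv v).2 hvT) hvM hr hra
      exact ⟨P, h2, h1⟩
    obtain ⟨e⟩ := hsep ⟨⟨M, hdM⟩, ⟨g, hg⟩, ⟨w, h3w⟩⟩ hcommon
    -- at any prime `p ∤ T`: `ι(a_p(g)) = a_p` by transport and uniqueness of Frobenius polynomials
    have hpM : ¬ p ∣ M := fun h ↦ hpT (h.trans (hML.trans hLT))
    obtain ⟨v, hpv⟩ : ∃ v : HeightOneSpectrum (𝓞 ℚ), ((primesEquiv v : Nat.Primes) : ℕ) = p :=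
      ⟨(primesEquiv (R := 𝓞 ℚ)).symm ⟨p, hp⟩,
        congrArg Subtype.val ((primesEquiv (R := 𝓞 ℚ)).apply_symm_apply ⟨p, hp⟩)⟩
    obtain ⟨r, hr⟩ := hg.exists_ringOfIntegers_coe_eq_cuspCoeff p
    refine ⟨r, hr, ?_⟩
    have hιr := ringHom_apply_eq_of_equiv_of_frobCharpoly ρ a htr hg j₀ hj₀ (ι M g hg w h3w)
      (hρ' M g hg w h3w) e v (by rw [hpv]; exact hpT) (by rw [hpv]; exact hnotS p hp hpT)
      (by rw [hpv]; exact hpM) (by rw [hpv]; exact hr)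
    rw [hpv] at hιr
    rw [← hι M g hg w h3w, map_sub, map_intCast, sub_eq_zero]
    exact hιr

end Separation

/-! ## § 4 Serre's weight: level `L` with `9 ∤ L`, and the norm image at level `N`, `27 ∤ N` -/

section SerreWeight

set_option maxHeartbeats 800000 in
/-- **Serre's weight of an irreducible mod-`3` system occurring in `H₁(X₀(L), ℤ)`, `9 ∤ L`, is at
most `4`** — GRANTED Deligne's Thm. 6.1 (`h61`), Edixhoven's Thm. 4.5 (`hE`) and
Darmon–Diamond–Taylor Thm. 3.1 (g) (`hD`).  Let `ρ̄ : Γ_ℚ → GL₂(𝔽₃)` be continuous and irreducible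
with `charpoly ρ̄(Frob_p) = X² − a_p X + p` at the primes `p ∤ T` (`3 ∣ T ≠ 0`), `L ∣ T`,
`9 ∤ L`, and let `S₀` be the arithmetic separating set.  If some `y ∈ Λ_L ∖ 3Λ_L`,
`Λ_L = H₁(X₀(L), ℤ)`, has `(T_p − a_p)^{k_p} y ∈ 3Λ_L` for the primes `p ≠ 3` of `S₀`, then for
every algebraically closed discrete `k` of characteristic `3` and `j : 𝔽₃ → k` there are a local
restriction datum `loc` at `3` and a residue embedding `ι` with `k(ρ̄ ⊗_j k) ≤ 4`.  Road: `y` gives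
a newform `g₀` of weight `2` and level `M ∣ L` with `a_p(g₀) ≡ a_p (mod 𝔐)` on `S₀`, `𝔐 ∋ 3` a
maximal ideal of `𝓞_{K_{g₀}}` (Deligne–Serre 6.11, Eichler–Shimura, lying over:
`exists_isNewform0_of_genEigenvector_mod_three`, `exists_maximal_ideal_over_ker`); by the
separating set the congruence holds at all `p ∤ T`; so `ρ̄ ⊗ k` and the semisimple `ρ̄_{g₀,𝔐} ⊗ k`
of Thm. 6.1 share their Frobenius polynomials off `T` and are isomorphic (Lemme 3.2), i.e.
`ρ̄ ⊗ k` is attached to `liftToGamma1 M 2 g₀` through `𝓞_K → 𝓞_K/𝔐 ↪ k`; `ρ̄ ⊗ k` is irreducible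
and odd with `det = χ̄₃ ≠ 1` on `I₃`, the level `M` has `9 ∤ M` and trivial character, so
`k(ρ̄ ⊗ k) ≤ 3 + 1` (`Automorphic.serreWeight_le_add_one_of_weightTwo_newform`: Thm. 3.1 (f)/(g),
Edixhoven 4.5, Serre §2.4/§2.8). [cite: DarmonDiamondTaylor1995, Thm. 3.1 (a),(f),(g) (p. 86) and p. 87]
[cite: DeligneSerreASENS1974, Lemme 3.2, Thm. 6.1, Lemme 6.11, 8.6] [cite: Edixhoven1992, Thm. 4.5]
[cite: Serre1987, §2.4, §2.8 Prop. 4, (3.2.3)] -/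
theorem serreWeight_le_four_of_genEigenvector_mod_three
    (h61 : DeligneSerre1974.thm61_exists_adicGaloisRep)
    (hE : Automorphic.edixhoven1992_serreWeight_le_weight_of_newform)
    (hD : Automorphic.darmonDiamondTaylor1995_ordinary_of_weightTwo_newform_dvd_level)
    (L : ℕ) [NeZero L] (h9 : ¬ 3 ^ 2 ∣ L) {T : ℕ} (hT : T ≠ 0) (h3T : 3 ∣ T) (hLT : L ∣ T)
    (ρ : ModPGaloisRep ℚ (ZMod 3) 2)
    (hirr : ∀ W : Submodule (ZMod 3) (Fin 2 → ZMod 3),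
      (∀ (g : absoluteGaloisGroup ℚ) (x : Fin 2 → ZMod 3), x ∈ W →
        ((ρ g : GL (Fin 2) (ZMod 3)) : Matrix (Fin 2) (Fin 2) (ZMod 3)).mulVec x ∈ W) →
        W = ⊥ ∨ W = ⊤)
    (a : ℕ → ℤ)
    (htr : ∀ (v : HeightOneSpectrum (𝓞 ℚ)), ¬ ((primesEquiv v : Nat.Primes) : ℕ) ∣ T →
      ∀ 𝔓 ∈ v.primesAbove, ∀ φ : absoluteGaloisGroup ℚ, IsArithFrobAt (𝓞 ℚ) φ 𝔓 →
        ((ρ φ : GL (Fin 2) (ZMod 3)) : Matrix (Fin 2) (Fin 2) (ZMod 3)).charpoly =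
          X ^ 2 - C ((a ((primesEquiv v : Nat.Primes) : ℕ) : ℤ) : ZMod 3) * X +
            C ((((primesEquiv v : Nat.Primes) : ℕ) : ℕ) : ZMod 3)) :
    ∃ S₀ : Finset ℕ, (∀ p ∈ S₀, p.Prime ∧ ¬ p ∣ T) ∧
      ((∃ y : periodHomologyHecke L,
          (∀ u : periodHomologyHecke L, y ≠ (3 : ℕ) • u) ∧
          ∀ (p : ℕ) (hp : p.Prime), p ≠ 3 → p ∈ S₀ →
            ∃ (k : ℕ) (u : periodHomologyHecke L),
              (HeckeRing0.T L 2 p hp - (a p : HeckeRing0 L 2)) ^ k • y = (3 : ℕ) • u) →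
        ∀ (k : Type) [Field k] [TopologicalSpace k] [DiscreteTopology k] [CharP k 3]
          [IsAlgClosed k] (j : ZMod 3 →+* k) (hj : Continuous j),
          ∃ (loc : ModPGaloisRep.LocalRestrictionAt 3 (FramedRep.baseChange j hj ρ))
            (ι : absIntegers 𝒪[loc.F] loc.F ⧸ absMaximalIdeal loc.F →+* k),
            ModPGaloisRep.serreWeight 3 (FramedRep.baseChange j hj ρ) loc ι ≤ 4) := by
  classical
  obtain ⟨S₀, hS₀, hsep⟩ :=
    exists_finset_congruence_newforms_of_modThree_rep h61 ρ hirr hT h3T a htr L hLT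
  refine ⟨S₀, hS₀, ?_⟩
  rintro ⟨y, hne, hy⟩ k _ _ _ _ _ j hj
  -- ### the newform `g₀` of level `M ∣ L` carrying the system (Deligne–Serre 6.11, Eichler–Shimura)
  obtain ⟨P, ψ, σ, M, hM, hML, g₀, -, -, hfin, hσinj, hg₀, hpk⟩ :=
    exists_isNewform0_of_genEigenvector_mod_three L S₀ a y hy hne
  haveI : NeZero M := hM
  haveI := hfin
  haveI hK : NumberField (coeffCharField (liftToGamma1 M 2 g₀)) :=
    GreenbergSelmer.numberField_coeffCharField_liftToGamma1 hg₀
  -- `σ` takes values in `K = K_{g₀}` (its generators go to `a_p(g₀)`)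
  have hσK : ∀ r, σ r ∈ coeffCharField (liftToGamma1 M 2 g₀) := by
    set φ : ↥(Algebra.adjoin ℤ {t : HeckeRing0 L 2 | ∃ (p : ℕ) (hp : p.Prime),
        p ≠ 3 ∧ p ∈ S₀ ∧ t = HeckeRing0.T L 2 p hp}) →+* ℂ := σ.comp (Ideal.Quotient.mk P)
      with hφdef
    have hφ : ∀ u, σ (Ideal.Quotient.mk P u) = φ u := fun u ↦ rfl
    intro r
    obtain ⟨⟨t, ht⟩, rfl⟩ := Ideal.Quotient.mk_surjective r
    rw [hφ]
    induction ht using Algebra.adjoin_induction with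
    | mem x hx =>
      obtain ⟨p, hp, hp3, hpS, rfl⟩ := hx
      have hpL : ¬ p ∣ L := fun h ↦ (hS₀ p hpS).2 (h.trans hLT)
      rw [← hφ, ← (hpk p hp hp3 hpS).2 hpL, ← cuspCoeff_liftToGamma1_eq g₀ p]
      exact cuspCoeff_mem_coeffCharField _ p
    | algebraMap z =>
      have h : (⟨algebraMap ℤ (HeckeRing0 L 2) z, Subalgebra.algebraMap_mem _ z⟩ :
          ↥(Algebra.adjoin ℤ {t : HeckeRing0 L 2 | ∃ (p : ℕ) (hp : p.Prime),
            p ≠ 3 ∧ p ∈ S₀ ∧ t = HeckeRing0.T L 2 p hp})) = (z : _) :=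
        Subtype.ext (by simp)
      rw [h, map_intCast φ]
      exact intCast_mem _ z
    | add x y hx hy ihx ihy =>
      have h : (⟨x + y, add_mem hx hy⟩ :
          ↥(Algebra.adjoin ℤ {t : HeckeRing0 L 2 | ∃ (p : ℕ) (hp : p.Prime),
            p ≠ 3 ∧ p ∈ S₀ ∧ t = HeckeRing0.T L 2 p hp})) = ⟨x, hx⟩ + ⟨y, hy⟩ := rfl
      rw [h, map_add φ]
      exact add_mem ihx ihy
    | mul x y hx hy ihx ihy =>
      have h : (⟨x * y, mul_mem hx hy⟩ :
          ↥(Algebra.adjoin ℤ {t : HeckeRing0 L 2 | ∃ (p : ℕ) (hp : p.Prime),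
            p ≠ 3 ∧ p ∈ S₀ ∧ t = HeckeRing0.T L 2 p hp})) = ⟨x, hx⟩ * ⟨y, hy⟩ := rfl
      rw [h, map_mul φ]
      exact mul_mem ihx ihy
  -- ### a maximal ideal `𝔐 ∋ 3` of `𝓞_K` with `a_p(g₀) ≡ a_p (mod 𝔐)` on `S₀` (lying over)
  obtain ⟨jO, 𝔐, h𝔐max, hjσ, h3𝔐, hcong⟩ :=
    exists_maximal_ideal_over_ker (coeffCharField (liftToGamma1 M 2 g₀)) σ hσinj hσK
      Nat.prime_three ψ
  have h3ne : ((3 : ℕ) : 𝓞 (coeffCharField (liftToGamma1 M 2 g₀))) ≠ 0 := by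
    exact_mod_cast (by norm_num : (3 : ℕ) ≠ 0)
  let w : HeightOneSpectrum (𝓞 (coeffCharField (liftToGamma1 M 2 g₀))) :=
    { asIdeal := 𝔐
      isPrime := h𝔐max.isPrime
      ne_bot := fun h ↦ h3ne (by
        have h3 := h3𝔐
        rw [h] at h3
        exact (Submodule.mem_bot _).mp h3) }
  have h3w : ((3 : ℕ) : 𝓞 (coeffCharField (liftToGamma1 M 2 g₀))) ∈ w.asIdeal := h3𝔐
  have hS₀cong : ∀ p ∈ S₀, ∃ r : 𝓞 (coeffCharField (liftToGamma1 M 2 g₀)),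
      ((r : coeffCharField (liftToGamma1 M 2 g₀)) : ℂ) = cuspCoeff g₀ p ∧
        r - (a p : 𝓞 (coeffCharField (liftToGamma1 M 2 g₀))) ∈ w.asIdeal := by
    intro p hpS
    obtain ⟨hp, hpT⟩ := hS₀ p hpS
    have hp3 : p ≠ 3 := fun h ↦ hpT (h ▸ h3T)
    have hpL : ¬ p ∣ L := fun h ↦ hpT (h.trans hLT)
    refine ⟨jO (Ideal.Quotient.mk P ⟨HeckeRing0.T L 2 p hp,
      Algebra.subset_adjoin ⟨p, hp, hp3, hpS, rfl⟩⟩), ?_, hcong _ (a p) (hpk p hp hp3 hpS).1⟩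
    exact (hjσ _).trans ((hpk p hp hp3 hpS).2 hpL).symm
  -- all congruences off `T`
  have hcongr := hsep M hML g₀ hg₀ w h3w hS₀cong
  -- ### the reduction `𝓞_K → k` with kernel `w` and the representations over `k`
  obtain ⟨ιO, hιO⟩ := exists_ringHom_ringOfIntegers_ker_eq (coeffCharField (liftToGamma1 M 2 g₀))
    w Nat.prime_three h3w k
  let ιf : coeffCharIntegers (liftToGamma1 M 2 g₀) →+* k := ιO
  obtain ⟨ρ', hρ', hρ'ss⟩ :=
    DeligneSerre1974.exists_isGaloisRepOfNewform1Int_liftToGamma1_of_thm61 h61 (by norm_num)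
      hg₀ 3 ιf
  have hirrk : (FramedGaloisRep.toGaloisRep (K := ℚ) (FramedRep.baseChange j hj ρ)).IsIrreducible :=
    ModPGaloisRep.isIrreducible_baseChange_of_frobCharpoly (by decide) ρ hirr hT h3T a htr j hj
  have hssk : (FramedGaloisRep.toGaloisRep (K := ℚ) (FramedRep.baseChange j hj ρ)).IsSemisimple := by
    haveI : Representation.IsIrreducible
        (FramedGaloisRep.toGaloisRep (K := ℚ) (FramedRep.baseChange j hj ρ)).toRepresentation :=
      hirrk
    change ComplementedLattice _
    infer_instance
  have hnotS : ∀ q : ℕ, q.Prime → ¬ q ∣ T → q ∉ {q | q ∣ M * 3} := by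
    intro q hq hqT h
    rcases (Nat.Prime.dvd_mul hq).mp h with h | h
    · exact hqT (h.trans (hML.trans hLT))
    · exact hqT (((Nat.prime_dvd_prime_iff_eq hq Nat.prime_three).mp h) ▸ h3T)
  -- common Frobenius polynomials at every place `v ∤ T`, whence `ρ' ≅ ρ̄ ⊗ k` (Lemme 3.2)
  have hST : ∀ v ∉ {v : HeightOneSpectrum (𝓞 ℚ) | ((primesEquiv v : Nat.Primes) : ℕ) ∣ T},
      ∃ P : k[X], FramedGaloisRep.HasFrobCharpolyAt v P ρ' ∧
        FramedGaloisRep.HasFrobCharpolyAt v P (FramedRep.baseChange j hj ρ) := by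
    intro v hvT
    have hvT : ¬ ((primesEquiv v : Nat.Primes) : ℕ) ∣ T := hvT
    obtain ⟨r, hr, hrw⟩ := hcongr _ (primesEquiv v).2 hvT
    have hvM : ¬ ((primesEquiv v : Nat.Primes) : ℕ) ∣ M := fun h ↦ hvT (h.trans (hML.trans hLT))
    have hra : ιO r = ((a ((primesEquiv v : Nat.Primes) : ℕ) : ℤ) : k) := by
      have h := (hιO _).mpr hrw
      rwa [map_sub, map_intCast, sub_eq_zero] at h
    exact exists_common_hasFrobCharpolyAt_of_congr ρ a htr hg₀ j hj ιf hρ' v hvT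
      (hnotS _ (primesEquiv v).2 hvT) hvM hr hra
  obtain ⟨e⟩ := FramedGaloisRep.nonempty_equiv_of_hasFrobCharpolyAt_of_finite_of_discrete'
    (finite_heightOneSpectrum_rat_dvd' hT) ρ' (FramedRep.baseChange j hj ρ) hρ'ss hssk hST
  have hρk : IsGaloisRepOfNewform1Int (liftToGamma1 M 2 g₀) ιf {q | q ∣ M * 3}
      (FramedRep.baseChange j hj ρ) := hρ'.of_equiv e
  -- ### local data at `3`, oddness, and the weight bound
  obtain ⟨loc, ιres, hdet⟩ :=
    ModPGaloisRep.exists_localRestrictionAt_det_ne_one_of_frobCharpoly (by decide) ρ hT h3T a htr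
      k j hj
  have hoddρ := ModPGaloisRep.isOdd_of_frobCharpoly ρ hT h3T a htr
  have hodd : FramedGaloisRep.IsOdd (K := ℚ) (FramedRep.baseChange j hj ρ) := by
    intro φ c hc
    rw [FramedRep.baseChange_apply, Matrix.GeneralLinearGroup.map_det, hoddρ φ c hc]
    ext
    simp
  have hf₁ : IsNewform1 (liftToGamma1 M 2 g₀) := (isNewform1_liftToGamma1_iff_holds M 2 g₀).mpr hg₀
  have h9M : ¬ 3 ^ 2 ∣ M := fun h ↦ h9 (h.trans hML)
  have hψ : ¬ 3 ∣ (nebentypus (liftToGamma1 M 2 g₀)).conductor := by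
    rw [nebentypus_liftToGamma1_holds M 2 hg₀.ne_zero, DirichletCharacter.conductor_one]
    norm_num
  refine ⟨loc, ιres, ?_⟩
  have h := Automorphic.serreWeight_le_add_one_of_weightTwo_newform hE hD 3 (by decide)
    (liftToGamma1 M 2 g₀) hf₁ h9M hψ k (FramedRep.baseChange j hj ρ) hirrk hodd ιf hρk loc ιres
    hdet
  exact h

/-- **Irreducible mod-`3` systems in the `t`-norm image of `H₁(X₀(N), ℤ)`, `9 ∣ N`, `27 ∤ N`, have
Serre weight `≤ 4`** — the statement of the named fact `normImage_modThree_serreWeight_le_four`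
at the levels with `27 ∤ N`, GRANTED Deligne's Thm. 6.1 (`h61`), Edixhoven's Thm. 4.5 (`hE`) and
Darmon–Diamond–Taylor Thm. 3.1 (g) (`hD`).  With `Λ = H₁(X₀(N), ℤ)`, `Nm = 1 + t + t²`: there is a
finite set `S₀` of primes such that if some `z ∈ Λ` has `Nm z ∉ 3Λ` and `Nm((T_p − a_p)^k z) ∈ 3Λ`
for the primes `p ≠ 3` of `S₀`, then `k(ρ̄ ⊗_j k) ≤ 4` at some local restriction datum at `3`
and residue embedding, for every algebraically closed discrete `k` of characteristic `3`.  Proof: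
`Nm Λ_N ≅ π_*Λ_N ⊆ Λ_{N/3}` Hecke-equivariantly away from `3` (Harrison 2011 §2; the tree's
`exists_genEigenvector_level_div_three_of_normInt`), so the system occurs in `Λ_{N/3} ⊗ 𝔽₃`, and
`9 ∤ N/3`: apply `serreWeight_le_four_of_genEigenvector_mod_three` at level `N/3` with `T = 3N`.
[cite: DarmonDiamondTaylor1995, Thm. 3.1 (a),(f),(g) (p. 86) and Thm. 1.29 (p. 37)]
[cite: Serre1987, §2.2–2.4] [cite: Harrison2011X0108, §2] [cite: Edixhoven1992, Thm. 4.5] -/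
theorem serreWeight_le_four_of_normImage_mod_three
    (h61 : DeligneSerre1974.thm61_exists_adicGaloisRep)
    (hE : Automorphic.edixhoven1992_serreWeight_le_weight_of_newform)
    (hD : Automorphic.darmonDiamondTaylor1995_ordinary_of_weightTwo_newform_dvd_level)
    (N : ℕ) [NeZero N] (h9 : 3 ^ 2 ∣ N) (h27 : ¬ 3 ^ 3 ∣ N) (ρ : ModPGaloisRep ℚ (ZMod 3) 2)
    (hirr : ∀ W : Submodule (ZMod 3) (Fin 2 → ZMod 3),
      (∀ (g : absoluteGaloisGroup ℚ) (x : Fin 2 → ZMod 3), x ∈ W →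
        ((ρ g : GL (Fin 2) (ZMod 3)) : Matrix (Fin 2) (Fin 2) (ZMod 3)).mulVec x ∈ W) →
        W = ⊥ ∨ W = ⊤)
    (a : ℕ → ℤ)
    (htr : ∀ (v : HeightOneSpectrum (𝓞 ℚ)), ¬ ((primesEquiv v : Nat.Primes) : ℕ) ∣ 3 * N →
      ∀ 𝔓 ∈ v.primesAbove, ∀ φ : absoluteGaloisGroup ℚ, IsArithFrobAt (𝓞 ℚ) φ 𝔓 →
        ((ρ φ : GL (Fin 2) (ZMod 3)) : Matrix (Fin 2) (Fin 2) (ZMod 3)).charpoly =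
          X ^ 2 - C ((a ((primesEquiv v : Nat.Primes) : ℕ) : ℤ) : ZMod 3) * X +
            C ((((primesEquiv v : Nat.Primes) : ℕ) : ℕ) : ZMod 3)) :
    ∃ S₀ : Finset ℕ,
      (∃ z : periodHomologyHecke N,
        (¬ ∃ u : periodHomologyHecke N, normInt N h9 z = (3 : ℕ) • u) ∧
        ∀ (p : ℕ) (hp : p.Prime), p ≠ 3 → p ∈ S₀ →
          ∃ (k : ℕ) (u : periodHomologyHecke N),
            normInt N h9 ((HeckeRing0.T N 2 p hp - (a p : HeckeRing0 N 2)) ^ k • z) = (3 : ℕ) • u) →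
      ∀ (k : Type) [Field k] [TopologicalSpace k] [DiscreteTopology k] [CharP k 3] [IsAlgClosed k]
        (j : ZMod 3 →+* k) (hj : Continuous j),
        ∃ (loc : ModPGaloisRep.LocalRestrictionAt 3 (FramedRep.baseChange j hj ρ))
          (ι : absIntegers 𝒪[loc.F] loc.F ⧸ absMaximalIdeal loc.F →+* k),
          ModPGaloisRep.serreWeight 3 (FramedRep.baseChange j hj ρ) loc ι ≤ 4 := by
  have h3N : 3 ∣ N := (dvd_pow_self 3 two_ne_zero).trans h9
  haveI : NeZero (N / 3) :=
    ⟨(Nat.div_pos (Nat.le_of_dvd (Nat.pos_of_ne_zero (NeZero.ne N)) h3N) three_pos).ne'⟩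
  have h9' : ¬ 3 ^ 2 ∣ N / 3 := by
    intro h
    apply h27
    have h' : 3 * 3 ^ 2 ∣ 3 * (N / 3) := mul_dvd_mul_left 3 h
    rwa [Nat.mul_div_cancel' h3N] at h'
  have hT : 3 * N ≠ 0 := mul_ne_zero three_ne_zero (NeZero.ne N)
  have hLT : N / 3 ∣ 3 * N := (Nat.div_dvd_of_dvd h3N).trans (dvd_mul_left N 3)
  obtain ⟨S₀, -, hA⟩ := serreWeight_le_four_of_genEigenvector_mod_three h61 hE hD (N / 3) h9' hT
    (dvd_mul_right 3 N) hLT ρ hirr a htr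
  refine ⟨S₀, ?_⟩
  rintro ⟨z, hzne, hz⟩
  obtain ⟨y, hy, hyne⟩ :=
    exists_genEigenvector_level_div_three_of_normInt N h9 S₀ a z hz (fun u h ↦ hzne ⟨u, h⟩)
  exact hA ⟨y, hyne, hy⟩

end SerreWeight

end Literature.NumberTheory.EllipticCurves

end
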